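import Summits.QuantumFields.YangMills.Theses.TwistExponentGap
import Summits.QuantumFields.YangMills.Theorems.TwistExponentGapPeriodicToronFloorToronBox
import Literature.MathematicalPhysics.QuantumFieldTheory.WilsonEnergyConvexity
import HarnessLib

/-!
# `TwistExponentGap.PeriodicToronFloor` (item stmt-QuantumFields-24055): the periodic toron floor
# `Z_{β,S}(1;q) ≥ c · β^{−(3S⁴−1)·D/2}` for every compact `G` with a faithful unitary lattice representation

Crux r4 of route `TwistExponentGap` (seat ym-idea-4, LINE g13-A, DRAFT by design → `MarginalTwistOnset.FixedTorusCriterionFailure` ⟨16128⟩).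
On the torus `(ℤ/S)⁴`, `S ≥ 2`, the UNTWISTED Wilson partition function of a compact group `G` seen through a faithful unitary representation
`r` (the periodic sector `z = 1` of the route's inline twisted partition function `Z`) satisfies `Z_{β,S}(1;q) ≥ c·β^{−(3S⁴−1)·D/2}` for `β ≥ 1`,
with `D = dimE r.ρ` the dimension of the Lie algebra of `ρ(G)` — the toron zero modes gain `β^{D}` over the naive tree-gauge Gaussian count
`β^{−(3S⁴+1)D/2}`.

Proof (the item's plan, [cite: Luscher1983, §2]; [cite: Vanbaal2001]; [cite: KollerVanbaal1986]; gauge fixing [cite: Chatterjee2016, §9]):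
* (helper module `TwistExponentGapPeriodicToronFloorToronBox`, §1) Hilbert–Schmidt algebra: the plaquette word `(Cᵢa)(Cⱼb)(Cᵢa')⁻¹(Cⱼb')⁻¹` is within `Σ‖ρ·−1‖ + 2‖ρCᵢ−1‖‖ρCⱼ−1‖` of `1` (drop the four
  fluctuation letters by unitary invariance of the norm; the commutator `CᵢCⱼCᵢ⁻¹Cⱼ⁻¹ − 1 = (CᵢCⱼ − CⱼCᵢ)Cᵢ⁻¹Cⱼ⁻¹` and
  `CᵢCⱼ − CⱼCᵢ = (Cᵢ−1)(Cⱼ−1) − (Cⱼ−1)(Cᵢ−1)`).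
* §2 THE TORON BOX forces a small action: if every link `V(x,μ)` is `t₂`-close to its seam letter (`C μ` when the link crosses the seam
  `x_μ = S−1`, else `1`) and the letters are `t₁`-close to `1`, every plaquette is `(4t₂ + 2t₁²)`-close to `1` — the two `μ`-links of a
  `(μ,ν)`-plaquette cross the `μ`-seam together — so `S(V) ≤ (4t₂+2t₁²)²/2 · #P` (`N − Re tr ρ g = ½‖ρ g − 1‖²`, ✓`DoublingOfRV.sub_re_trace_le`).
* §3 In the comb gauge of ✓`LangevinControlUVFemtoCurvatureTwoPointCTorus{CombGauge,Lower}` (the `3S⁴+1` off-comb links are i.i.d. Haar,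
  ✓`map_combSection_pi_haar`) the toron event — the 4 leader seam links `(−e_μ, μ)` in `B_{t₁}`, every other off-comb link within `t₂` of its
  letter — has product-Haar mass EXACTLY `Haar(B_{t₁})⁴ · Haar(B_{t₂})^{3S⁴−3}`: the skew product `(leaders, rest) ↦ (leaders, letter⁻¹·rest)`
  preserves product Haar (`MeasurePreserving.skew_product`, `measurePreserving_piEquivPiSubtypeProd`, left invariance; template
  ✓`…CSkewHaar.map_pi_haar_twoSided_eq_of_pred`), and on it the gauge-fixed configuration lies in the toron box of §2.
* §4 Markov at the level `βS ≤ 18·#P` (✓`exp_mul_measureReal_le_integral_exp`) with `t₁ = β^{−1/4}`, `t₂ = t₁² = β^{−1/2}`, and the small-ball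
  bound ✓`FreeEnergyLogCoefficient.exists_haar_gball_ge` (`Haar(B_δ) ≥ C δ^{D}`): `Z ≥ e^{−18·#P}·(C t₁^{D})⁴·(C t₁^{2D})^{3S⁴−3} = c·β^{−(3S⁴−1)D/2}`.

HONEST FRAMING: the periodic FLOOR (the cheap direction) of an instrument line; the ceilings `StratifiedTwistCeiling` ⟨24053⟩ / `RigidTwistCeiling`
⟨24054⟩ and the target ⟨16128⟩ remain OPEN; no rung / summit statement is proved; the Yang–Mills mass gap is NOT proved (width seat
ym-line-sfw-p2-w3 g35 of cell ym-idea-1, free hands).  THEOREMS ONLY (0 `def`, 0 `sorry`), standard axioms.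
-/

set_option autoImplicit false

noncomputable section

open scoped Matrix.Norms.Frobenius ENNReal BigOperators
open MeasureTheory
open Literature.MathematicalPhysics.QuantumFieldTheory
open Summit.QuantumFields.YangMills.Theorems.FreeEnergyLogCoefficient (dimE exists_haar_gball_ge measurableSet_gball norm_rho_sub_rho)
open Summit.QuantumFields.YangMills.Theorems.FemtoCurvatureTwoPoint.DoublingOfRV (norm_rho_mul_sub_one_le norm_rho_inv_sub_one
  sub_re_trace_le card_plaquette)
open Summit.QuantumFields.YangMills.Theorems.FemtoCurvatureTwoPointC.TorusGauge

namespace Summit.QuantumFields.YangMills.Theorems.TwistExponentGap.ToronFloor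

/-! ## §4 The periodic toron floor, by name -/

section Main

open Summit.QuantumFields.YangMills.Theorems.FreeEnergyLogCoefficient (dimE)

/-- ★★ **`PeriodicToronFloor` holds** (item stmt-QuantumFields-24055 of route `TwistExponentGap`, BY NAME): for every compact group `G` with a
faithful unitary lattice representation `r`, every inline twisted partition function `Z`, every torus side `S ≥ 2` and plane `q` there are `c > 0`,
`β₀` with `Z_{β,S}(1;q) ≥ c·β^{−(3S⁴−1)·D/2}` for `β ≥ β₀`, `D = dimE r.ρ` — with `β₀ = 1` and
`c = e^{−18·#P}·C^{3S⁴+1}`, `C` the small-ball constant of `exists_haar_gball_ge`.  Proof: the periodic sector `z = 1` is the Wilson partition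
function (`partitionFunction_toReal_eq_integral`); Markov at the level `β S ≤ 18·#P` (`exp_mul_measureReal_le_integral_exp`); the sublevel set
contains the toron box, of product-Haar mass `Haar(B_t)⁴ Haar(B_{t²})^{3S⁴−3}`, `t = β^{−1/4}` (`pow_mul_pow_le_measureReal_wilsonAction_le`);
small balls `Haar(B_δ) ≥ C δ^D`.  No ceiling, no rung, no summit statement is proved; the YM mass gap is NOT proved.
[cite: Chatterjee2016, Lemma 9.3 and Cor. 6.3] [cite: Luscher1983, §2] [cite: Vanbaal2001] -/
theorem twistExponentGap_periodicToronFloor_proof :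
    Summit.QuantumFields.YangMills.Theses.TwistExponentGap.PeriodicToronFloor := by
  intro G _ _ _ _
  letI : MeasurableSpace G := borel G
  haveI : BorelSpace G := ⟨rfl⟩
  intro r Z hZ S hS2 q
  -- countability from the faithful representation
  haveI : SecondCountableTopology (Matrix (Fin r.N) (Fin r.N) ℂ) :=
    inferInstanceAs (SecondCountableTopology (Fin r.N → Fin r.N → ℂ))
  have hemb : Topology.IsClosedEmbedding r.ρ := r.continuous.isClosedEmbedding r.injective
  haveI : SecondCountableTopology G := hemb.isEmbedding.secondCountableTopology
  -- the torus side `S = n + 1`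
  obtain ⟨n, rfl⟩ : ∃ n, S = n + 1 := ⟨S - 1, by omega⟩
  obtain ⟨C, hC, hball⟩ := exists_haar_gball_ge r.ρ r.continuous r.injective r.mem_unitary
  set P : ℕ := Fintype.card (Plaquette 4 (n + 1)) with hPdef
  set D : ℕ := dimE r.ρ with hDdef
  set R : ℕ := 3 * (n + 1) ^ 4 - 3 with hRdef
  have hR3 : 3 ≤ 3 * (n + 1) ^ 4 := by
    have : 1 ≤ (n + 1) ^ 4 := Nat.one_le_pow _ _ (Nat.succ_pos n)
    omega
  have hRreal : (R : ℝ) = 3 * ((n + 1 : ℕ) : ℝ) ^ 4 - 3 := by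
    rw [hRdef, Nat.cast_sub hR3]; push_cast; ring
  refine ⟨Real.exp (-(18 * (P : ℝ))) * (C ^ 4 * C ^ R), by positivity, 1, fun β hβ => ?_⟩
  have hβ0 : 0 < β := by linarith
  -- the radius `t = β^{-1/4}`
  set t : ℝ := β ^ (-(1 / 4 : ℝ)) with ht
  have ht0 : 0 < t := Real.rpow_pos_of_pos hβ0 _
  have ht1 : t ≤ 1 := Real.rpow_le_one_of_one_le_of_nonpos hβ (by norm_num)
  have ht20 : 0 < t ^ 2 := pow_pos ht0 2
  have ht21 : t ^ 2 ≤ 1 := pow_le_one₀ ht0.le ht1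
  have ht4 : t ^ 4 = β⁻¹ := by
    rw [ht, ← Real.rpow_natCast, ← Real.rpow_mul hβ0.le, ← Real.rpow_neg_one]
    norm_num
  -- the exponent: `t^{4D + 2DR} = β^{-(3S⁴-1)D/2}`
  have htpow : t ^ (4 * D + 2 * D * R) = β ^ (-(((3 * ((n + 1 : ℕ) : ℝ) ^ 4 - 1) * (D : ℝ)) / 2)) := by
    rw [ht, ← Real.rpow_natCast, ← Real.rpow_mul hβ0.le]
    congr 1
    push_cast
    rw [hRreal]
    push_cast
    ring
  -- the periodic sector is the Wilson partition function
  have hZeq : Z β (n + 1) 1 q =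
      ∫ U, Real.exp (-β * wilsonAction r.ρ U) ∂(Measure.pi fun _ : Edge 4 (n + 1) => haarProbability G) := by
    rw [hZ]
    refine integral_congr_ae (ae_of_all _ fun U => ?_)
    simp only [ite_self, one_mul, neg_mul, wilsonAction]
  -- small balls
  have hB1 : C * t ^ D ≤ (haarProbability G).real {g : G | ‖r.ρ g - 1‖ ≤ t} :=
    (ENNReal.ofReal_le_iff_le_toReal (measure_ne_top _ _)).1 (hball t ht0 ht1)
  have hB2 : C * (t ^ 2) ^ D ≤ (haarProbability G).real {g : G | ‖r.ρ g - 1‖ ≤ t ^ 2} :=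
    (ENNReal.ofReal_le_iff_le_toReal (measure_ne_top _ _)).1 (hball (t ^ 2) ht20 ht21)
  -- the toron box inside the sublevel set, and Markov
  set K : ℝ := (4 * t ^ 2 + 2 * t ^ 2) ^ 2 / 2 * (P : ℝ) with hK
  have hbox := pow_mul_pow_le_measureReal_wilsonAction_le (n := n) r.ρ r.continuous r.mem_unitary ht0.le ht20.le
  have hmarkov := exp_mul_measureReal_le_integral_exp (d := 4) (L := n + 1) r.ρ r.continuous hβ0.le K
  have hβK : -β * K = -(18 * (P : ℝ)) := by
    have e1 : K = 18 * t ^ 4 * P := by rw [hK]; ring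
    rw [e1, ht4]; field_simp
  rw [hZeq]
  calc Real.exp (-(18 * (P : ℝ))) * (C ^ 4 * C ^ R) * β ^ (-(((3 * ((n + 1 : ℕ) : ℝ) ^ 4 - 1) * (D : ℝ)) / 2))
      = Real.exp (-(18 * (P : ℝ))) * ((C * t ^ D) ^ 4 * (C * (t ^ 2) ^ D) ^ R) := by
        rw [← htpow]; ring
    _ ≤ Real.exp (-(18 * (P : ℝ))) * ((haarProbability G).real {g : G | ‖r.ρ g - 1‖ ≤ t} ^ 4 *
          (haarProbability G).real {g : G | ‖r.ρ g - 1‖ ≤ t ^ 2} ^ R) := by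
        have h4 : (C * t ^ D) ^ 4 ≤ (haarProbability G).real {g : G | ‖r.ρ g - 1‖ ≤ t} ^ 4 :=
          pow_le_pow_left₀ (by positivity) hB1 4
        have hRR : (C * (t ^ 2) ^ D) ^ R ≤ (haarProbability G).real {g : G | ‖r.ρ g - 1‖ ≤ t ^ 2} ^ R :=
          pow_le_pow_left₀ (by positivity) hB2 R
        exact mul_le_mul_of_nonneg_left (mul_le_mul h4 hRR (by positivity) (by positivity)) (Real.exp_pos _).le
    _ ≤ Real.exp (-(18 * (P : ℝ))) * (Measure.pi fun _ : Edge 4 (n + 1) => haarProbability G).real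
          {U : GaugeConfig 4 (n + 1) G | wilsonAction r.ρ U ≤ K} :=
        mul_le_mul_of_nonneg_left hbox (Real.exp_pos _).le
    _ = Real.exp (-β * K) * (Measure.pi fun _ : Edge 4 (n + 1) => haarProbability G).real
          {U : GaugeConfig 4 (n + 1) G | wilsonAction r.ρ U ≤ K} := by rw [hβK]
    _ ≤ ∫ U, Real.exp (-β * wilsonAction r.ρ U) ∂(Measure.pi fun _ : Edge 4 (n + 1) => haarProbability G) := hmarkov

end Main

end Summit.QuantumFields.YangMills.Theorems.TwistExponentGap.ToronFloor

end
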